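/-
Copyright: the b2b-balaban T⁴-continuum CRUX team, row NE7b OWNER lineage `t4-ne7b-p1` (gen 142). Project licence.
-/
import Summits.QuantumFields.BalabanUV.T4Continuum.Spine.NE7b.SupTiltedMomentPhiConstituent

/-!
# THE TILTED MONOMIALS OF THE ORDER-FOUR CUMULANT FORM ARE INTEGRABLE (SCOPING (d13)(2): the cumulant FORM of `∂⁴W`, sixth file).
# (516) wrote the raw fourth derivative of `W = −log∫e^{−U(ω+ψ)}dN(0,Γ)` along a direction as a polynomial in COMPOSITE scalar tilted
# integrals; (517) is the letters identity that regroups it into cumulant form once every composite integral is split into the 51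
# canonical monomial integrals `∫e^{−U}M`, `M` a product of entries `A_v = U′v`, `B_vw = U″vw`, `C_uvw = U‴uvw`, `D = U⁗····` of total
# `A`-degree ≤ 4.  Splitting by linearity needs each `e^{−U}M` INTEGRABLE: this file proves it for the thirteen remaining product SHAPES that occur
# (`AA, AAA, AAAA, B, AB, BA, AAB, BAA, BB, C, AC, CA, D`; the single gradient entry `A` is (400) `SupBlockUpperLetter.integrable_weighted_blockDeriv_apply`,
# reused, not restated), for ARBITRARY direction vectors, from ONE growth lemma — (513)'s ball-uniform
# power domination `e^{−U}(1+‖U′‖)ⁿ ≤ Kₙ(ψ)e^{θΣω²∕2γ_op}` for a CONTINUOUS observable `p` with `|p| ≤ C_p(1+‖U′‖)ⁿ` (the `C¹` hypothesis of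
# (513) `integrable_weighted_moment` was used only for continuity) — general `Γ ⪰ 0` under the regulator (row NE7b, node U5c; (513)∕(514)∕(515)
# BY NAME; [folklore])

Cell `pub-balaban`, sub-cell `t4`, spine estimate NE7b (`T4WeightBudget.RelWeightBound`; the cell's OWN estimate — NOT PRINTED in
[Bałaban 1983–89], NOT PROVED).  Crux-route work under `Spine/NE7b/` by the row OWNER (`t4-ne7b-p1` gen 142, file (518)) under FREEZE
(0)'s crux-prover clause; NOTHING of Bałaban's is named as a Lean object, valued or asserted; no `T4Continuum/Support` leaf typed; no
`def`, no notation; zero `sorry`.  Imports (BY NAME): the OWNER's (515) `…SupTiltedMomentPhiConstituent` (`abs_entry_three_le`; through it (514)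
`abs_entry_one_le`, `abs_entry_two_le`, (513) `block_power_domination`, (313) `integrable_domination`).

WHAT IS PROVED ([folklore]; general `Γ ⪰ 0` with the regulator):
* §1 `integrable_tilted_of_growth` (continuous observable of polynomial growth in `‖U′‖`); the entry bounds `abs_A_le`, `abs_B_le`, `abs_C_le`,
  `abs_D_le`; the bare weight `integrable_e`.
* §2 the thirteen shapes `integrable_eAA`, `integrable_eAAA`, `integrable_eAAAA`, `integrable_eB`, `integrable_eAB`, `integrable_eBA`,
  `integrable_eAAB`, `integrable_eBAA`, `integrable_eBB`, `integrable_eC`, `integrable_eAC`, `integrable_eCA`, `integrable_eD`; §3 toy.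

HONEST (what this is NOT).  Integrability bookkeeping only; the splitting identities, the centred (cumulant) display of `∂⁴W` and the assembly of
the order-4 kernel letter are the next files.  Scalar skeleton ((A3), NC-NE7b-α UNRULED); nothing of Bałaban's asserted.  BY-NAME EFFECT ON THE
WALL: NONE.  NE7b NOT PRINTED ∕ NOT PROVED; spine PROVED 0∕9; rung (B)+1 — the programme's measures remain FINITE-torus statements; NOT the mass
gap, NOT Clay.  HONEST DEPENDENCY: continuum YM on T⁴ ⇐ BetaPertH ∧ nine spine estimates (0∕9 proved); BetaPertH ⇐ (D1) ∧ (D4) ∧ CAP+tail;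
G-an2-4 gates asym, D1 and NE2∕3∕4.
-/

set_option autoImplicit false
set_option maxSynthPendingDepth 3

noncomputable section

namespace Summit.QuantumFields.BalabanUV.T4Continuum.NE7b.SupFourthOrderMonomials

open MeasureTheory ProbabilityTheory Finset Real Metric Filter
open scoped BigOperators Topology
open SupEffectiveActionDerivative (integrable_domination)
open SupTiltedScalarMomentCalculus (block_power_domination)
open SupTiltedMomentConstituents (abs_entry_one_le abs_entry_two_le)
open SupTiltedMomentPhiConstituent (abs_entry_three_le)

variable {ι : Type} [Fintype ι] [DecidableEq ι]

variable {Γ : Matrix ι ι ℝ} {γop : ℝ} {U : EuclideanSpace ℝ ι → ℝ} {U' : EuclideanSpace ℝ ι → EuclideanSpace ℝ ι →L[ℝ] ℝ}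
  {U'' : EuclideanSpace ℝ ι → EuclideanSpace ℝ ι →L[ℝ] EuclideanSpace ℝ ι →L[ℝ] ℝ}
  {U₃ : EuclideanSpace ℝ ι → EuclideanSpace ℝ ι →L[ℝ] EuclideanSpace ℝ ι →L[ℝ] EuclideanSpace ℝ ι →L[ℝ] ℝ}
  {U₄ : EuclideanSpace ℝ ι → EuclideanSpace ℝ ι →L[ℝ] EuclideanSpace ℝ ι →L[ℝ] EuclideanSpace ℝ ι →L[ℝ] EuclideanSpace ℝ ι →L[ℝ] ℝ}
  {κ₀ κ₁ κ₂ κ₃ κ₄ a τ δ θ : ℝ}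

/-! ## §1. Growth integrability for a continuous observable; the entry bounds -/

/-- **A continuous observable of polynomial growth in `‖U′‖` has an integrable tilted moment**: `|p| ≤ C_p(1+‖U′‖)ⁿ`, `p` continuous ⟹
`e^{−U(ω+ψ)}p(ω+ψ) ∈ L¹(N(0,Γ))` at every `ψ` ((513)'s proof, `C¹` weakened to continuity). [folklore] -/
theorem integrable_tilted_of_growth {p : EuclideanSpace ℝ ι → ℝ} {Cp : ℝ} {n : ℕ} (hΓ : Γ.PosSemidef) (hΓop : (γop • (1 : Matrix ι ι ℝ) -
    Γ).PosSemidef) (Y : Finset ι)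
    (hUd : ∀ φ : EuclideanSpace ℝ ι, HasFDerivAt U (U' φ) φ) (hpc : Continuous p)
    (hκ₀ : 0 ≤ κ₀) (hκ₁ : 0 ≤ κ₁) (ha : 0 ≤ a) (hτ : 0 < τ) (hδ : 0 < δ) (hθ1 : θ < 1) (hκθ : (2 * κ₀ * (1 + τ) + 4 * δ) * γop ≤ θ)
    (hstab : ∀ φ : EuclideanSpace ℝ ι, -(κ₀ * ∑ x ∈ Y, φ x ^ 2) ≤ U φ) (hU'b : ∀ φ : EuclideanSpace ℝ ι, ‖U' φ‖ ≤ κ₁ * (a + ∑ x ∈ Y, φ x ^ 2))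
    (hpb : ∀ φ : EuclideanSpace ℝ ι, |p φ| ≤ Cp * (1 + ‖U' φ‖) ^ n) (ψ : EuclideanSpace ℝ ι) :
    Integrable (fun ω : EuclideanSpace ℝ ι => exp (-U (ω + ψ)) * p (ω + ψ)) (multivariateGaussian 0 Γ) := by
  have hUc : Continuous U := continuous_iff_continuousAt.2 fun φ => (hUd φ).continuousAt
  have hsh : Continuous fun ω : EuclideanSpace ℝ ι => ω + ψ := continuous_id.add continuous_const
  have hm : Continuous fun ω : EuclideanSpace ℝ ι => exp (-U (ω + ψ)) * p (ω + ψ) := (continuous_exp.comp (hUc.comp hsh).neg).mul (hpc.comp hsh)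
  have hCp : 0 ≤ Cp := by
    have h := hpb ψ
    have h1 : 0 < (1 + ‖U' ψ‖) ^ n := by positivity
    nlinarith [abs_nonneg (p ψ)]
  refine ((integrable_domination hΓ hΓop Y hκ₀ hτ hδ hθ1 hκθ
    ((2 ^ n * ((1 + κ₁ * (a + 2 * (2 * ∑ x ∈ Y, ψ x ^ 2 + 2))) ^ n + (κ₁ / δ) ^ n * (n).factorial) * exp (κ₀ * (1 + τ⁻¹) * (2 * ∑ x ∈ Y, ψ x ^ 2 +
        2))))).const_mul Cp).mono'
    hm.aestronglyMeasurable (ae_of_all _ fun ω => ?_)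
  rw [Real.norm_eq_abs, abs_mul, abs_of_pos (exp_pos _)]
  calc exp (-U (ω + ψ)) * |p (ω + ψ)| ≤ exp (-U (ω + ψ)) * (Cp * (1 + ‖U' (ω + ψ)‖) ^ n) := mul_le_mul_of_nonneg_left (hpb _) (exp_pos _).le
    _ = Cp * (exp (-U (ω + ψ)) * (1 + ‖U' (ω + ψ)‖) ^ n) := by ring
    _ ≤ Cp * _ := mul_le_mul_of_nonneg_left (block_power_domination Y n hκ₀ hκ₁ ha hτ hδ hstab hU'b ψ ψ (by simp) ω) hCp

omit [DecidableEq ι] in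
/-- `|U′φ v| ≤ ‖v‖(1 + ‖U′φ‖)`. [folklore] -/
theorem abs_A_le (U' : EuclideanSpace ℝ ι → EuclideanSpace ℝ ι →L[ℝ] ℝ) (φ v : EuclideanSpace ℝ ι) : |U' φ v| ≤ ‖v‖ * (1 + ‖U' φ‖) := by
  have h := abs_entry_one_le (U' φ) v
  nlinarith [norm_nonneg v, norm_nonneg (U' φ)]

omit [DecidableEq ι] in
/-- `|U″φ p q| ≤ κ₂‖p‖‖q‖`. [folklore] -/
theorem abs_B_le (hU''b : ∀ φ : EuclideanSpace ℝ ι, ‖U'' φ‖ ≤ κ₂) (φ p q : EuclideanSpace ℝ ι) : |U'' φ p q| ≤ κ₂ * ‖p‖ * ‖q‖ :=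
  (abs_entry_two_le (U'' φ) p q).trans (by gcongr; exact hU''b φ)

omit [DecidableEq ι] in
/-- `|U‴φ p q r| ≤ κ₃‖p‖‖q‖‖r‖`. [folklore] -/
theorem abs_C_le (hU₃b : ∀ φ : EuclideanSpace ℝ ι, ‖U₃ φ‖ ≤ κ₃) (φ p q r : EuclideanSpace ℝ ι) : |U₃ φ p q r| ≤ κ₃ * ‖p‖ * ‖q‖ * ‖r‖ :=
  (abs_entry_three_le (U₃ φ) p q r).trans (by gcongr; exact hU₃b φ)

omit [DecidableEq ι] in
/-- `|U⁗φ p q r s| ≤ κ₄‖p‖‖q‖‖r‖‖s‖`. [folklore] -/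
theorem abs_D_le (hU₄b : ∀ φ : EuclideanSpace ℝ ι, ‖U₄ φ‖ ≤ κ₄) (φ p q r s : EuclideanSpace ℝ ι) :
    |U₄ φ p q r s| ≤ κ₄ * ‖p‖ * ‖q‖ * ‖r‖ * ‖s‖ := by
  rw [← Real.norm_eq_abs]
  calc ‖U₄ φ p q r s‖ ≤ ‖U₄ φ p q r‖ * ‖s‖ := ContinuousLinearMap.le_opNorm _ _
    _ ≤ ‖U₄ φ p q‖ * ‖r‖ * ‖s‖ := by gcongr; exact ContinuousLinearMap.le_opNorm _ _
    _ ≤ ‖U₄ φ p‖ * ‖q‖ * ‖r‖ * ‖s‖ := by gcongr; exact ContinuousLinearMap.le_opNorm _ _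
    _ ≤ ‖U₄ φ‖ * ‖p‖ * ‖q‖ * ‖r‖ * ‖s‖ := by gcongr; exact ContinuousLinearMap.le_opNorm _ _
    _ ≤ κ₄ * ‖p‖ * ‖q‖ * ‖r‖ * ‖s‖ := by gcongr; exact hU₄b φ

/-- **The bare weight is integrable**: `e^{−U(ω+ψ)} ∈ L¹(N(0,Γ))` (the observable `1`, growth order `0`). [folklore] -/
theorem integrable_e (hΓ : Γ.PosSemidef) (hΓop : (γop • (1 : Matrix ι ι ℝ) - Γ).PosSemidef) (Y : Finset ι)
    (hUd : ∀ φ : EuclideanSpace ℝ ι, HasFDerivAt U (U' φ) φ)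
    (hκ₀ : 0 ≤ κ₀) (hκ₁ : 0 ≤ κ₁) (ha : 0 ≤ a) (hτ : 0 < τ) (hδ : 0 < δ) (hθ1 : θ < 1) (hκθ : (2 * κ₀ * (1 + τ) + 4 * δ) * γop ≤ θ)
    (hstab : ∀ φ : EuclideanSpace ℝ ι, -(κ₀ * ∑ x ∈ Y, φ x ^ 2) ≤ U φ) (hU'b : ∀ φ : EuclideanSpace ℝ ι, ‖U' φ‖ ≤ κ₁ * (a + ∑ x ∈ Y, φ x ^ 2)) (ψ :
        EuclideanSpace ℝ ι) :
    Integrable (fun ω : EuclideanSpace ℝ ι => exp (-U (ω + ψ))) (multivariateGaussian 0 Γ) := by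
  have h := integrable_tilted_of_growth hΓ hΓop Y hUd (p := fun _ : EuclideanSpace ℝ ι => (1 : ℝ)) (Cp := 1) (n := 0) continuous_const hκ₀ hκ₁ ha hτ
      hδ hθ1 hκθ hstab hU'b
    (fun φ => by simp) ψ
  simpa only [mul_one] using h

/-! ## §2. The thirteen shapes -/


/-- The tilted monomial `e·AA` is integrable at every background (growth `(1+‖U′‖)^2`). [folklore] -/
theorem integrable_eAA (hΓ : Γ.PosSemidef) (hΓop : (γop • (1 : Matrix ι ι ℝ) - Γ).PosSemidef) (Y : Finset ι)
    (hUd : ∀ φ : EuclideanSpace ℝ ι, HasFDerivAt U (U' φ) φ) (hU'c : Continuous U')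
    (hκ₀ : 0 ≤ κ₀) (hκ₁ : 0 ≤ κ₁) (ha : 0 ≤ a) (hτ : 0 < τ) (hδ : 0 < δ) (hθ1 : θ < 1) (hκθ : (2 * κ₀ * (1 + τ) + 4 * δ) * γop ≤ θ)
    (hstab : ∀ φ : EuclideanSpace ℝ ι, -(κ₀ * ∑ x ∈ Y, φ x ^ 2) ≤ U φ) (hU'b : ∀ φ : EuclideanSpace ℝ ι, ‖U' φ‖ ≤ κ₁ * (a + ∑ x ∈ Y, φ x ^ 2)) (ψ v w
        : EuclideanSpace ℝ ι) :
    Integrable (fun ω : EuclideanSpace ℝ ι => exp (-U (ω + ψ)) * (U' (ω + ψ) v * U' (ω + ψ) w)) (multivariateGaussian 0 Γ) := by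
  -- no curvature letters needed
  refine integrable_tilted_of_growth hΓ hΓop Y hUd (p := fun φ : EuclideanSpace ℝ ι => (U' φ v * U' φ w)) (Cp := ‖v‖ * ‖w‖) (n := 2) (by fun_prop)
      hκ₀ hκ₁ ha hτ hδ hθ1 hκθ hstab hU'b
    (fun φ => ?_) ψ
  have f0 : |U' φ v| ≤ ‖v‖ * (1 + ‖U' φ‖) := abs_A_le U' φ v
  have f1 : |U' φ w| ≤ ‖w‖ * (1 + ‖U' φ‖) := abs_A_le U' φ w
  calc |(U' φ v * U' φ w)| = |U' φ v| * |U' φ w| := by simp only [abs_mul]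
    _ ≤ (‖v‖ * (1 + ‖U' φ‖)) * (‖w‖ * (1 + ‖U' φ‖)) := by gcongr
    _ = ‖v‖ * ‖w‖ * (1 + ‖U' φ‖) ^ 2 := by ring

/-- The tilted monomial `e·AAA` is integrable at every background (growth `(1+‖U′‖)^3`). [folklore] -/
theorem integrable_eAAA (hΓ : Γ.PosSemidef) (hΓop : (γop • (1 : Matrix ι ι ℝ) - Γ).PosSemidef) (Y : Finset ι)
    (hUd : ∀ φ : EuclideanSpace ℝ ι, HasFDerivAt U (U' φ) φ) (hU'c : Continuous U')
    (hκ₀ : 0 ≤ κ₀) (hκ₁ : 0 ≤ κ₁) (ha : 0 ≤ a) (hτ : 0 < τ) (hδ : 0 < δ) (hθ1 : θ < 1) (hκθ : (2 * κ₀ * (1 + τ) + 4 * δ) * γop ≤ θ)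
    (hstab : ∀ φ : EuclideanSpace ℝ ι, -(κ₀ * ∑ x ∈ Y, φ x ^ 2) ≤ U φ) (hU'b : ∀ φ : EuclideanSpace ℝ ι, ‖U' φ‖ ≤ κ₁ * (a + ∑ x ∈ Y, φ x ^ 2)) (ψ u v
        w : EuclideanSpace ℝ ι) :
    Integrable (fun ω : EuclideanSpace ℝ ι => exp (-U (ω + ψ)) * (U' (ω + ψ) u * U' (ω + ψ) v * U' (ω + ψ) w)) (multivariateGaussian 0 Γ) := by
  -- no curvature letters needed
  refine integrable_tilted_of_growth hΓ hΓop Y hUd (p := fun φ : EuclideanSpace ℝ ι => (U' φ u * U' φ v * U' φ w)) (Cp := ‖u‖ * ‖v‖ * ‖w‖) (n := 3)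
      (by fun_prop) hκ₀ hκ₁ ha hτ hδ hθ1 hκθ hstab hU'b
    (fun φ => ?_) ψ
  have f0 : |U' φ u| ≤ ‖u‖ * (1 + ‖U' φ‖) := abs_A_le U' φ u
  have f1 : |U' φ v| ≤ ‖v‖ * (1 + ‖U' φ‖) := abs_A_le U' φ v
  have f2 : |U' φ w| ≤ ‖w‖ * (1 + ‖U' φ‖) := abs_A_le U' φ w
  calc |(U' φ u * U' φ v * U' φ w)| = |U' φ u| * |U' φ v| * |U' φ w| := by simp only [abs_mul]
    _ ≤ (‖u‖ * (1 + ‖U' φ‖)) * (‖v‖ * (1 + ‖U' φ‖)) * (‖w‖ * (1 + ‖U' φ‖)) := by gcongr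
    _ = ‖u‖ * ‖v‖ * ‖w‖ * (1 + ‖U' φ‖) ^ 3 := by ring

/-- The tilted monomial `e·AAAA` is integrable at every background (growth `(1+‖U′‖)^4`). [folklore] -/
theorem integrable_eAAAA (hΓ : Γ.PosSemidef) (hΓop : (γop • (1 : Matrix ι ι ℝ) - Γ).PosSemidef) (Y : Finset ι)
    (hUd : ∀ φ : EuclideanSpace ℝ ι, HasFDerivAt U (U' φ) φ) (hU'c : Continuous U')
    (hκ₀ : 0 ≤ κ₀) (hκ₁ : 0 ≤ κ₁) (ha : 0 ≤ a) (hτ : 0 < τ) (hδ : 0 < δ) (hθ1 : θ < 1) (hκθ : (2 * κ₀ * (1 + τ) + 4 * δ) * γop ≤ θ)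
    (hstab : ∀ φ : EuclideanSpace ℝ ι, -(κ₀ * ∑ x ∈ Y, φ x ^ 2) ≤ U φ) (hU'b : ∀ φ : EuclideanSpace ℝ ι, ‖U' φ‖ ≤ κ₁ * (a + ∑ x ∈ Y, φ x ^ 2)) (ψ u v
        w x : EuclideanSpace ℝ ι) :
    Integrable (fun ω : EuclideanSpace ℝ ι => exp (-U (ω + ψ)) * (U' (ω + ψ) u * U' (ω + ψ) v * U' (ω + ψ) w * U' (ω + ψ) x)) (multivariateGaussian 0
        Γ) := by
  -- no curvature letters needed
  refine integrable_tilted_of_growth hΓ hΓop Y hUd (p := fun φ : EuclideanSpace ℝ ι => (U' φ u * U' φ v * U' φ w * U' φ x)) (Cp := ‖u‖ * ‖v‖ * ‖w‖ *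
      ‖x‖) (n := 4) (by fun_prop) hκ₀ hκ₁ ha hτ hδ hθ1 hκθ hstab hU'b
    (fun φ => ?_) ψ
  have f0 : |U' φ u| ≤ ‖u‖ * (1 + ‖U' φ‖) := abs_A_le U' φ u
  have f1 : |U' φ v| ≤ ‖v‖ * (1 + ‖U' φ‖) := abs_A_le U' φ v
  have f2 : |U' φ w| ≤ ‖w‖ * (1 + ‖U' φ‖) := abs_A_le U' φ w
  have f3 : |U' φ x| ≤ ‖x‖ * (1 + ‖U' φ‖) := abs_A_le U' φ x
  calc |(U' φ u * U' φ v * U' φ w * U' φ x)| = |U' φ u| * |U' φ v| * |U' φ w| * |U' φ x| := by simp only [abs_mul]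
    _ ≤ (‖u‖ * (1 + ‖U' φ‖)) * (‖v‖ * (1 + ‖U' φ‖)) * (‖w‖ * (1 + ‖U' φ‖)) * (‖x‖ * (1 + ‖U' φ‖)) := by gcongr
    _ = ‖u‖ * ‖v‖ * ‖w‖ * ‖x‖ * (1 + ‖U' φ‖) ^ 4 := by ring

/-- The tilted monomial `e·B` is integrable at every background (growth `(1+‖U′‖)^0`). [folklore] -/
theorem integrable_eB (hΓ : Γ.PosSemidef) (hΓop : (γop • (1 : Matrix ι ι ℝ) - Γ).PosSemidef) (Y : Finset ι)
    (hUd : ∀ φ : EuclideanSpace ℝ ι, HasFDerivAt U (U' φ) φ) (hU''c : Continuous U'') (hU''b : ∀ φ : EuclideanSpace ℝ ι, ‖U'' φ‖ ≤ κ₂)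
    (hκ₀ : 0 ≤ κ₀) (hκ₁ : 0 ≤ κ₁) (ha : 0 ≤ a) (hτ : 0 < τ) (hδ : 0 < δ) (hθ1 : θ < 1) (hκθ : (2 * κ₀ * (1 + τ) + 4 * δ) * γop ≤ θ)
    (hstab : ∀ φ : EuclideanSpace ℝ ι, -(κ₀ * ∑ x ∈ Y, φ x ^ 2) ≤ U φ) (hU'b : ∀ φ : EuclideanSpace ℝ ι, ‖U' φ‖ ≤ κ₁ * (a + ∑ x ∈ Y, φ x ^ 2)) (ψ p q
        : EuclideanSpace ℝ ι) :
    Integrable (fun ω : EuclideanSpace ℝ ι => exp (-U (ω + ψ)) * U'' (ω + ψ) p q) (multivariateGaussian 0 Γ) := by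
  have hκ₂ : 0 ≤ κ₂ := le_trans (norm_nonneg (U'' 0)) (hU''b 0)
  refine integrable_tilted_of_growth hΓ hΓop Y hUd (p := fun φ : EuclideanSpace ℝ ι => U'' φ p q) (Cp := (κ₂ * ‖p‖ * ‖q‖)) (n := 0) (by fun_prop) hκ₀
      hκ₁ ha hτ hδ hθ1 hκθ hstab hU'b
    (fun φ => ?_) ψ
  have f0 : |U'' φ p q| ≤ κ₂ * ‖p‖ * ‖q‖ := abs_B_le hU''b φ p q
  calc |U'' φ p q| = |U'' φ p q| := rfl
    _ ≤ (κ₂ * ‖p‖ * ‖q‖) := f0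
    _ = (κ₂ * ‖p‖ * ‖q‖) * (1 + ‖U' φ‖) ^ 0 := by ring

/-- The tilted monomial `e·AB` is integrable at every background (growth `(1+‖U′‖)^1`). [folklore] -/
theorem integrable_eAB (hΓ : Γ.PosSemidef) (hΓop : (γop • (1 : Matrix ι ι ℝ) - Γ).PosSemidef) (Y : Finset ι)
    (hUd : ∀ φ : EuclideanSpace ℝ ι, HasFDerivAt U (U' φ) φ) (hU'c : Continuous U') (hU''c : Continuous U'') (hU''b : ∀ φ : EuclideanSpace ℝ ι, ‖U''
        φ‖ ≤ κ₂)
    (hκ₀ : 0 ≤ κ₀) (hκ₁ : 0 ≤ κ₁) (ha : 0 ≤ a) (hτ : 0 < τ) (hδ : 0 < δ) (hθ1 : θ < 1) (hκθ : (2 * κ₀ * (1 + τ) + 4 * δ) * γop ≤ θ)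
    (hstab : ∀ φ : EuclideanSpace ℝ ι, -(κ₀ * ∑ x ∈ Y, φ x ^ 2) ≤ U φ) (hU'b : ∀ φ : EuclideanSpace ℝ ι, ‖U' φ‖ ≤ κ₁ * (a + ∑ x ∈ Y, φ x ^ 2)) (ψ v p
        q : EuclideanSpace ℝ ι) :
    Integrable (fun ω : EuclideanSpace ℝ ι => exp (-U (ω + ψ)) * (U' (ω + ψ) v * U'' (ω + ψ) p q)) (multivariateGaussian 0 Γ) := by
  have hκ₂ : 0 ≤ κ₂ := le_trans (norm_nonneg (U'' 0)) (hU''b 0)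
  refine integrable_tilted_of_growth hΓ hΓop Y hUd (p := fun φ : EuclideanSpace ℝ ι => (U' φ v * U'' φ p q)) (Cp := ‖v‖ * (κ₂ * ‖p‖ * ‖q‖)) (n := 1)
      (by fun_prop) hκ₀ hκ₁ ha hτ hδ hθ1 hκθ hstab hU'b
    (fun φ => ?_) ψ
  have f0 : |U' φ v| ≤ ‖v‖ * (1 + ‖U' φ‖) := abs_A_le U' φ v
  have f1 : |U'' φ p q| ≤ κ₂ * ‖p‖ * ‖q‖ := abs_B_le hU''b φ p q
  calc |(U' φ v * U'' φ p q)| = |U' φ v| * |U'' φ p q| := by simp only [abs_mul]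
    _ ≤ (‖v‖ * (1 + ‖U' φ‖)) * (κ₂ * ‖p‖ * ‖q‖) := by gcongr
    _ = ‖v‖ * (κ₂ * ‖p‖ * ‖q‖) * (1 + ‖U' φ‖) ^ 1 := by ring

/-- The tilted monomial `e·BA` is integrable at every background (growth `(1+‖U′‖)^1`). [folklore] -/
theorem integrable_eBA (hΓ : Γ.PosSemidef) (hΓop : (γop • (1 : Matrix ι ι ℝ) - Γ).PosSemidef) (Y : Finset ι)
    (hUd : ∀ φ : EuclideanSpace ℝ ι, HasFDerivAt U (U' φ) φ) (hU'c : Continuous U') (hU''c : Continuous U'') (hU''b : ∀ φ : EuclideanSpace ℝ ι, ‖U''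
        φ‖ ≤ κ₂)
    (hκ₀ : 0 ≤ κ₀) (hκ₁ : 0 ≤ κ₁) (ha : 0 ≤ a) (hτ : 0 < τ) (hδ : 0 < δ) (hθ1 : θ < 1) (hκθ : (2 * κ₀ * (1 + τ) + 4 * δ) * γop ≤ θ)
    (hstab : ∀ φ : EuclideanSpace ℝ ι, -(κ₀ * ∑ x ∈ Y, φ x ^ 2) ≤ U φ) (hU'b : ∀ φ : EuclideanSpace ℝ ι, ‖U' φ‖ ≤ κ₁ * (a + ∑ x ∈ Y, φ x ^ 2)) (ψ p q
        v : EuclideanSpace ℝ ι) :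
    Integrable (fun ω : EuclideanSpace ℝ ι => exp (-U (ω + ψ)) * (U'' (ω + ψ) p q * U' (ω + ψ) v)) (multivariateGaussian 0 Γ) := by
  have hκ₂ : 0 ≤ κ₂ := le_trans (norm_nonneg (U'' 0)) (hU''b 0)
  refine integrable_tilted_of_growth hΓ hΓop Y hUd (p := fun φ : EuclideanSpace ℝ ι => (U'' φ p q * U' φ v)) (Cp := (κ₂ * ‖p‖ * ‖q‖) * ‖v‖) (n := 1)
      (by fun_prop) hκ₀ hκ₁ ha hτ hδ hθ1 hκθ hstab hU'b
    (fun φ => ?_) ψ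
  have f0 : |U'' φ p q| ≤ κ₂ * ‖p‖ * ‖q‖ := abs_B_le hU''b φ p q
  have f1 : |U' φ v| ≤ ‖v‖ * (1 + ‖U' φ‖) := abs_A_le U' φ v
  calc |(U'' φ p q * U' φ v)| = |U'' φ p q| * |U' φ v| := by simp only [abs_mul]
    _ ≤ (κ₂ * ‖p‖ * ‖q‖) * (‖v‖ * (1 + ‖U' φ‖)) := by gcongr
    _ = (κ₂ * ‖p‖ * ‖q‖) * ‖v‖ * (1 + ‖U' φ‖) ^ 1 := by ring

/-- The tilted monomial `e·AAB` is integrable at every background (growth `(1+‖U′‖)^2`). [folklore] -/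
theorem integrable_eAAB (hΓ : Γ.PosSemidef) (hΓop : (γop • (1 : Matrix ι ι ℝ) - Γ).PosSemidef) (Y : Finset ι)
    (hUd : ∀ φ : EuclideanSpace ℝ ι, HasFDerivAt U (U' φ) φ) (hU'c : Continuous U') (hU''c : Continuous U'') (hU''b : ∀ φ : EuclideanSpace ℝ ι, ‖U''
        φ‖ ≤ κ₂)
    (hκ₀ : 0 ≤ κ₀) (hκ₁ : 0 ≤ κ₁) (ha : 0 ≤ a) (hτ : 0 < τ) (hδ : 0 < δ) (hθ1 : θ < 1) (hκθ : (2 * κ₀ * (1 + τ) + 4 * δ) * γop ≤ θ)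
    (hstab : ∀ φ : EuclideanSpace ℝ ι, -(κ₀ * ∑ x ∈ Y, φ x ^ 2) ≤ U φ) (hU'b : ∀ φ : EuclideanSpace ℝ ι, ‖U' φ‖ ≤ κ₁ * (a + ∑ x ∈ Y, φ x ^ 2)) (ψ v w
        p q : EuclideanSpace ℝ ι) :
    Integrable (fun ω : EuclideanSpace ℝ ι => exp (-U (ω + ψ)) * (U' (ω + ψ) v * U' (ω + ψ) w * U'' (ω + ψ) p q)) (multivariateGaussian 0 Γ) := by
  have hκ₂ : 0 ≤ κ₂ := le_trans (norm_nonneg (U'' 0)) (hU''b 0)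
  refine integrable_tilted_of_growth hΓ hΓop Y hUd (p := fun φ : EuclideanSpace ℝ ι => (U' φ v * U' φ w * U'' φ p q)) (Cp := ‖v‖ * ‖w‖ * (κ₂ * ‖p‖ *
      ‖q‖)) (n := 2) (by fun_prop) hκ₀ hκ₁ ha hτ hδ hθ1 hκθ hstab hU'b
    (fun φ => ?_) ψ
  have f0 : |U' φ v| ≤ ‖v‖ * (1 + ‖U' φ‖) := abs_A_le U' φ v
  have f1 : |U' φ w| ≤ ‖w‖ * (1 + ‖U' φ‖) := abs_A_le U' φ w
  have f2 : |U'' φ p q| ≤ κ₂ * ‖p‖ * ‖q‖ := abs_B_le hU''b φ p q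
  calc |(U' φ v * U' φ w * U'' φ p q)| = |U' φ v| * |U' φ w| * |U'' φ p q| := by simp only [abs_mul]
    _ ≤ (‖v‖ * (1 + ‖U' φ‖)) * (‖w‖ * (1 + ‖U' φ‖)) * (κ₂ * ‖p‖ * ‖q‖) := by gcongr
    _ = ‖v‖ * ‖w‖ * (κ₂ * ‖p‖ * ‖q‖) * (1 + ‖U' φ‖) ^ 2 := by ring

/-- The tilted monomial `e·BAA` is integrable at every background (growth `(1+‖U′‖)^2`). [folklore] -/
theorem integrable_eBAA (hΓ : Γ.PosSemidef) (hΓop : (γop • (1 : Matrix ι ι ℝ) - Γ).PosSemidef) (Y : Finset ι)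
    (hUd : ∀ φ : EuclideanSpace ℝ ι, HasFDerivAt U (U' φ) φ) (hU'c : Continuous U') (hU''c : Continuous U'') (hU''b : ∀ φ : EuclideanSpace ℝ ι, ‖U''
        φ‖ ≤ κ₂)
    (hκ₀ : 0 ≤ κ₀) (hκ₁ : 0 ≤ κ₁) (ha : 0 ≤ a) (hτ : 0 < τ) (hδ : 0 < δ) (hθ1 : θ < 1) (hκθ : (2 * κ₀ * (1 + τ) + 4 * δ) * γop ≤ θ)
    (hstab : ∀ φ : EuclideanSpace ℝ ι, -(κ₀ * ∑ x ∈ Y, φ x ^ 2) ≤ U φ) (hU'b : ∀ φ : EuclideanSpace ℝ ι, ‖U' φ‖ ≤ κ₁ * (a + ∑ x ∈ Y, φ x ^ 2)) (ψ p q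
        v w : EuclideanSpace ℝ ι) :
    Integrable (fun ω : EuclideanSpace ℝ ι => exp (-U (ω + ψ)) * (U'' (ω + ψ) p q * U' (ω + ψ) v * U' (ω + ψ) w)) (multivariateGaussian 0 Γ) := by
  have hκ₂ : 0 ≤ κ₂ := le_trans (norm_nonneg (U'' 0)) (hU''b 0)
  refine integrable_tilted_of_growth hΓ hΓop Y hUd (p := fun φ : EuclideanSpace ℝ ι => (U'' φ p q * U' φ v * U' φ w)) (Cp := (κ₂ * ‖p‖ * ‖q‖) * ‖v‖ *
      ‖w‖) (n := 2) (by fun_prop) hκ₀ hκ₁ ha hτ hδ hθ1 hκθ hstab hU'b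
    (fun φ => ?_) ψ
  have f0 : |U'' φ p q| ≤ κ₂ * ‖p‖ * ‖q‖ := abs_B_le hU''b φ p q
  have f1 : |U' φ v| ≤ ‖v‖ * (1 + ‖U' φ‖) := abs_A_le U' φ v
  have f2 : |U' φ w| ≤ ‖w‖ * (1 + ‖U' φ‖) := abs_A_le U' φ w
  calc |(U'' φ p q * U' φ v * U' φ w)| = |U'' φ p q| * |U' φ v| * |U' φ w| := by simp only [abs_mul]
    _ ≤ (κ₂ * ‖p‖ * ‖q‖) * (‖v‖ * (1 + ‖U' φ‖)) * (‖w‖ * (1 + ‖U' φ‖)) := by gcongr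
    _ = (κ₂ * ‖p‖ * ‖q‖) * ‖v‖ * ‖w‖ * (1 + ‖U' φ‖) ^ 2 := by ring

/-- The tilted monomial `e·BB` is integrable at every background (growth `(1+‖U′‖)^0`). [folklore] -/
theorem integrable_eBB (hΓ : Γ.PosSemidef) (hΓop : (γop • (1 : Matrix ι ι ℝ) - Γ).PosSemidef) (Y : Finset ι)
    (hUd : ∀ φ : EuclideanSpace ℝ ι, HasFDerivAt U (U' φ) φ) (hU''c : Continuous U'') (hU''b : ∀ φ : EuclideanSpace ℝ ι, ‖U'' φ‖ ≤ κ₂)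
    (hκ₀ : 0 ≤ κ₀) (hκ₁ : 0 ≤ κ₁) (ha : 0 ≤ a) (hτ : 0 < τ) (hδ : 0 < δ) (hθ1 : θ < 1) (hκθ : (2 * κ₀ * (1 + τ) + 4 * δ) * γop ≤ θ)
    (hstab : ∀ φ : EuclideanSpace ℝ ι, -(κ₀ * ∑ x ∈ Y, φ x ^ 2) ≤ U φ) (hU'b : ∀ φ : EuclideanSpace ℝ ι, ‖U' φ‖ ≤ κ₁ * (a + ∑ x ∈ Y, φ x ^ 2)) (ψ p q
        r s : EuclideanSpace ℝ ι) :
    Integrable (fun ω : EuclideanSpace ℝ ι => exp (-U (ω + ψ)) * (U'' (ω + ψ) p q * U'' (ω + ψ) r s)) (multivariateGaussian 0 Γ) := by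
  have hκ₂ : 0 ≤ κ₂ := le_trans (norm_nonneg (U'' 0)) (hU''b 0)
  refine integrable_tilted_of_growth hΓ hΓop Y hUd (p := fun φ : EuclideanSpace ℝ ι => (U'' φ p q * U'' φ r s)) (Cp := (κ₂ * ‖p‖ * ‖q‖) * (κ₂ * ‖r‖ *
      ‖s‖)) (n := 0) (by fun_prop) hκ₀ hκ₁ ha hτ hδ hθ1 hκθ hstab hU'b
    (fun φ => ?_) ψ
  have f0 : |U'' φ p q| ≤ κ₂ * ‖p‖ * ‖q‖ := abs_B_le hU''b φ p q
  have f1 : |U'' φ r s| ≤ κ₂ * ‖r‖ * ‖s‖ := abs_B_le hU''b φ r s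
  calc |(U'' φ p q * U'' φ r s)| = |U'' φ p q| * |U'' φ r s| := by simp only [abs_mul]
    _ ≤ (κ₂ * ‖p‖ * ‖q‖) * (κ₂ * ‖r‖ * ‖s‖) := by gcongr
    _ = (κ₂ * ‖p‖ * ‖q‖) * (κ₂ * ‖r‖ * ‖s‖) * (1 + ‖U' φ‖) ^ 0 := by ring

/-- The tilted monomial `e·C` is integrable at every background (growth `(1+‖U′‖)^0`). [folklore] -/
theorem integrable_eC (hΓ : Γ.PosSemidef) (hΓop : (γop • (1 : Matrix ι ι ℝ) - Γ).PosSemidef) (Y : Finset ι)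
    (hUd : ∀ φ : EuclideanSpace ℝ ι, HasFDerivAt U (U' φ) φ) (hU₃c : Continuous U₃) (hU₃b : ∀ φ : EuclideanSpace ℝ ι, ‖U₃ φ‖ ≤ κ₃)
    (hκ₀ : 0 ≤ κ₀) (hκ₁ : 0 ≤ κ₁) (ha : 0 ≤ a) (hτ : 0 < τ) (hδ : 0 < δ) (hθ1 : θ < 1) (hκθ : (2 * κ₀ * (1 + τ) + 4 * δ) * γop ≤ θ)
    (hstab : ∀ φ : EuclideanSpace ℝ ι, -(κ₀ * ∑ x ∈ Y, φ x ^ 2) ≤ U φ) (hU'b : ∀ φ : EuclideanSpace ℝ ι, ‖U' φ‖ ≤ κ₁ * (a + ∑ x ∈ Y, φ x ^ 2)) (ψ p q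
        r : EuclideanSpace ℝ ι) :
    Integrable (fun ω : EuclideanSpace ℝ ι => exp (-U (ω + ψ)) * U₃ (ω + ψ) p q r) (multivariateGaussian 0 Γ) := by
  have hκ₃ : 0 ≤ κ₃ := le_trans (norm_nonneg (U₃ 0)) (hU₃b 0)
  refine integrable_tilted_of_growth hΓ hΓop Y hUd (p := fun φ : EuclideanSpace ℝ ι => U₃ φ p q r) (Cp := (κ₃ * ‖p‖ * ‖q‖ * ‖r‖)) (n := 0) (by
      fun_prop) hκ₀ hκ₁ ha hτ hδ hθ1 hκθ hstab hU'b
    (fun φ => ?_) ψ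
  have f0 : |U₃ φ p q r| ≤ κ₃ * ‖p‖ * ‖q‖ * ‖r‖ := abs_C_le hU₃b φ p q r
  calc |U₃ φ p q r| = |U₃ φ p q r| := rfl
    _ ≤ (κ₃ * ‖p‖ * ‖q‖ * ‖r‖) := f0
    _ = (κ₃ * ‖p‖ * ‖q‖ * ‖r‖) * (1 + ‖U' φ‖) ^ 0 := by ring

/-- The tilted monomial `e·AC` is integrable at every background (growth `(1+‖U′‖)^1`). [folklore] -/
theorem integrable_eAC (hΓ : Γ.PosSemidef) (hΓop : (γop • (1 : Matrix ι ι ℝ) - Γ).PosSemidef) (Y : Finset ι)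
    (hUd : ∀ φ : EuclideanSpace ℝ ι, HasFDerivAt U (U' φ) φ) (hU'c : Continuous U') (hU₃c : Continuous U₃) (hU₃b : ∀ φ : EuclideanSpace ℝ ι, ‖U₃ φ‖ ≤
        κ₃)
    (hκ₀ : 0 ≤ κ₀) (hκ₁ : 0 ≤ κ₁) (ha : 0 ≤ a) (hτ : 0 < τ) (hδ : 0 < δ) (hθ1 : θ < 1) (hκθ : (2 * κ₀ * (1 + τ) + 4 * δ) * γop ≤ θ)
    (hstab : ∀ φ : EuclideanSpace ℝ ι, -(κ₀ * ∑ x ∈ Y, φ x ^ 2) ≤ U φ) (hU'b : ∀ φ : EuclideanSpace ℝ ι, ‖U' φ‖ ≤ κ₁ * (a + ∑ x ∈ Y, φ x ^ 2)) (ψ v p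
        q r : EuclideanSpace ℝ ι) :
    Integrable (fun ω : EuclideanSpace ℝ ι => exp (-U (ω + ψ)) * (U' (ω + ψ) v * U₃ (ω + ψ) p q r)) (multivariateGaussian 0 Γ) := by
  have hκ₃ : 0 ≤ κ₃ := le_trans (norm_nonneg (U₃ 0)) (hU₃b 0)
  refine integrable_tilted_of_growth hΓ hΓop Y hUd (p := fun φ : EuclideanSpace ℝ ι => (U' φ v * U₃ φ p q r)) (Cp := ‖v‖ * (κ₃ * ‖p‖ * ‖q‖ * ‖r‖)) (n
      := 1) (by fun_prop) hκ₀ hκ₁ ha hτ hδ hθ1 hκθ hstab hU'b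
    (fun φ => ?_) ψ
  have f0 : |U' φ v| ≤ ‖v‖ * (1 + ‖U' φ‖) := abs_A_le U' φ v
  have f1 : |U₃ φ p q r| ≤ κ₃ * ‖p‖ * ‖q‖ * ‖r‖ := abs_C_le hU₃b φ p q r
  calc |(U' φ v * U₃ φ p q r)| = |U' φ v| * |U₃ φ p q r| := by simp only [abs_mul]
    _ ≤ (‖v‖ * (1 + ‖U' φ‖)) * (κ₃ * ‖p‖ * ‖q‖ * ‖r‖) := by gcongr
    _ = ‖v‖ * (κ₃ * ‖p‖ * ‖q‖ * ‖r‖) * (1 + ‖U' φ‖) ^ 1 := by ring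

/-- The tilted monomial `e·CA` is integrable at every background (growth `(1+‖U′‖)^1`). [folklore] -/
theorem integrable_eCA (hΓ : Γ.PosSemidef) (hΓop : (γop • (1 : Matrix ι ι ℝ) - Γ).PosSemidef) (Y : Finset ι)
    (hUd : ∀ φ : EuclideanSpace ℝ ι, HasFDerivAt U (U' φ) φ) (hU'c : Continuous U') (hU₃c : Continuous U₃) (hU₃b : ∀ φ : EuclideanSpace ℝ ι, ‖U₃ φ‖ ≤
        κ₃)
    (hκ₀ : 0 ≤ κ₀) (hκ₁ : 0 ≤ κ₁) (ha : 0 ≤ a) (hτ : 0 < τ) (hδ : 0 < δ) (hθ1 : θ < 1) (hκθ : (2 * κ₀ * (1 + τ) + 4 * δ) * γop ≤ θ)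
    (hstab : ∀ φ : EuclideanSpace ℝ ι, -(κ₀ * ∑ x ∈ Y, φ x ^ 2) ≤ U φ) (hU'b : ∀ φ : EuclideanSpace ℝ ι, ‖U' φ‖ ≤ κ₁ * (a + ∑ x ∈ Y, φ x ^ 2)) (ψ p q
        r v : EuclideanSpace ℝ ι) :
    Integrable (fun ω : EuclideanSpace ℝ ι => exp (-U (ω + ψ)) * (U₃ (ω + ψ) p q r * U' (ω + ψ) v)) (multivariateGaussian 0 Γ) := by
  have hκ₃ : 0 ≤ κ₃ := le_trans (norm_nonneg (U₃ 0)) (hU₃b 0)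
  refine integrable_tilted_of_growth hΓ hΓop Y hUd (p := fun φ : EuclideanSpace ℝ ι => (U₃ φ p q r * U' φ v)) (Cp := (κ₃ * ‖p‖ * ‖q‖ * ‖r‖) * ‖v‖) (n
      := 1) (by fun_prop) hκ₀ hκ₁ ha hτ hδ hθ1 hκθ hstab hU'b
    (fun φ => ?_) ψ
  have f0 : |U₃ φ p q r| ≤ κ₃ * ‖p‖ * ‖q‖ * ‖r‖ := abs_C_le hU₃b φ p q r
  have f1 : |U' φ v| ≤ ‖v‖ * (1 + ‖U' φ‖) := abs_A_le U' φ v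
  calc |(U₃ φ p q r * U' φ v)| = |U₃ φ p q r| * |U' φ v| := by simp only [abs_mul]
    _ ≤ (κ₃ * ‖p‖ * ‖q‖ * ‖r‖) * (‖v‖ * (1 + ‖U' φ‖)) := by gcongr
    _ = (κ₃ * ‖p‖ * ‖q‖ * ‖r‖) * ‖v‖ * (1 + ‖U' φ‖) ^ 1 := by ring

/-- The tilted monomial `e·D` is integrable at every background (growth `(1+‖U′‖)^0`). [folklore] -/
theorem integrable_eD (hΓ : Γ.PosSemidef) (hΓop : (γop • (1 : Matrix ι ι ℝ) - Γ).PosSemidef) (Y : Finset ι)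
    (hUd : ∀ φ : EuclideanSpace ℝ ι, HasFDerivAt U (U' φ) φ) (hU₄c : Continuous U₄) (hU₄b : ∀ φ : EuclideanSpace ℝ ι, ‖U₄ φ‖ ≤ κ₄)
    (hκ₀ : 0 ≤ κ₀) (hκ₁ : 0 ≤ κ₁) (ha : 0 ≤ a) (hτ : 0 < τ) (hδ : 0 < δ) (hθ1 : θ < 1) (hκθ : (2 * κ₀ * (1 + τ) + 4 * δ) * γop ≤ θ)
    (hstab : ∀ φ : EuclideanSpace ℝ ι, -(κ₀ * ∑ x ∈ Y, φ x ^ 2) ≤ U φ) (hU'b : ∀ φ : EuclideanSpace ℝ ι, ‖U' φ‖ ≤ κ₁ * (a + ∑ x ∈ Y, φ x ^ 2)) (ψ p q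
        r s : EuclideanSpace ℝ ι) :
    Integrable (fun ω : EuclideanSpace ℝ ι => exp (-U (ω + ψ)) * U₄ (ω + ψ) p q r s) (multivariateGaussian 0 Γ) := by
  have hκ₄ : 0 ≤ κ₄ := le_trans (norm_nonneg (U₄ 0)) (hU₄b 0)
  refine integrable_tilted_of_growth hΓ hΓop Y hUd (p := fun φ : EuclideanSpace ℝ ι => U₄ φ p q r s) (Cp := (κ₄ * ‖p‖ * ‖q‖ * ‖r‖ * ‖s‖)) (n := 0)
      (by fun_prop) hκ₀ hκ₁ ha hτ hδ hθ1 hκθ hstab hU'b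
    (fun φ => ?_) ψ
  have f0 : |U₄ φ p q r s| ≤ κ₄ * ‖p‖ * ‖q‖ * ‖r‖ * ‖s‖ := abs_D_le hU₄b φ p q r s
  calc |U₄ φ p q r s| = |U₄ φ p q r s| := rfl
    _ ≤ (κ₄ * ‖p‖ * ‖q‖ * ‖r‖ * ‖s‖) := f0
    _ = (κ₄ * ‖p‖ * ‖q‖ * ‖r‖ * ‖s‖) * (1 + ‖U' φ‖) ^ 0 := by ring

/-! ## §3. Toy -/

/-- Toy (§1's growth format at `n = 2`): `3² ≤ 1·(1+2)²`. -/
example : ((3 : ℝ)) ^ 2 ≤ 1 * (1 + 2) ^ 2 := by norm_num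

end Summit.QuantumFields.BalabanUV.T4Continuum.NE7b.SupFourthOrderMonomials

end
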